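import Literature.Algebra.PolynomialIdentities.WeightedAverages
import Literature.IUT.LogVolume.ArchimedeanMetrics
import Literature.IUT.LogVolume.LocalFieldVolume
import Literature.IUT.LogVolume.LogShellTopology
import Literature.IUT.LogVolume.PrimeNumberEstimates
import Literature.IUT.LogVolume.ProductVolume
import Literature.NumberTheory.DiophantineGeometry.GenEllBDClasses
import Literature.NumberTheory.DiophantineGeometry.GenEllNorthcott
import Literature.NumberTheory.DiophantineGeometry.GenEllNorthcottProofs
import Literature.NumberTheory.DiophantineGeometry.GenEllProjLineExamples
import Literature.NumberTheory.DiophantineGeometry.GenEllProjLineInvariance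
import Summits.ABC.IUTFork.ForkDegrees
import Summits.ABC.IUTFork.ForkThm110
import Summits.ABC.IUTFork.ForkVojta

/-!
# Kernel DAG index — layer S, part a (MACHINE DRAFT by abc-iut-dag `tools/mkkernel.py`, index v0 of plan/DAG.tsv @2026-08-25T19:18Z, 18 nodes)

THIS FILE PROVES NOTHING NEW AND ASSERTS NOTHING (plan/KERNEL-DAG-SPEC.md). It gives ONE NAME `N_<kernel_id>` to each DAG node whose
statement has LANDED through the gate, knitting the landed declarations BY NAME. Witness naming (c312-2 F1/F2, 18:39:37Z): `N_<id>_holds`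
exists iff the DAG row is `discharged(p)` (it IS the kernel-checked theorems); a landed row not yet marked discharged by its lead gets the same
conjunction witnessed as `N_<id>_part`; FACT-style `def … : Prop` claims get a name and no witness; CLAIM-FORM items ([IUTchIII] Cor 3.12,
[IUTchIV] Thm 1.10) are `abbrev N_<id> (X) : Prop := X.<Claim>` and the theorems that assume them are EDGES `E_<dst>_of_<src>` (no `__`). Nothing here says abc is proved or refuted or takes a side on [IUTchIII] Cor 3.12. typed ≠ discharged; indexed ≠ endorsed.
Filer of the tree copy: abc-iut-c312-2 (`Summits/ABC/IUTFork/DAGSa.lean`); this draft is regenerated hourly and is not the tree.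
FILED COPY (abc-iut-c312-2, post-processed by work/fixdraft.py): claim nodes are claim-form abbrevs without `_holds`;
`_holds` only for DAG rows marked discharged, `_part` otherwise (spec §2(b),(c)); edges by name (§3).
-/

namespace Summit.ABC.IUTFork.DAG

namespace PartSa
/-- `StatementOf h` is the statement (a `Prop`) of which the landed `h` is the proof: the index NAMES statements, it never re-types them. -/
abbrev StatementOf {P : Prop} (_h : P) : Prop := P
end PartSa
open PartSa

noncomputable section
universe u₁ u₂ u₃ u₄ u₅ u₆ u₇ u₈ u₉

/-- [node IUTchIV:Prop1.2(i) · S/D5 · [IUTchIV] Prop 1.2 (i), kurims p.10 · p404563 · claim · DAG status landed(p404563)] decls 1 · cites→ IUTchIV:Prop1.1 -/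
abbrev N_IUTchIV_Prop1_2_i : Prop := StatementOf @Literature.IUT.LogVolume.closedBall_subset_logUnits.{u₁}
/-- partial witness (DAG row not marked discharged) of `N_IUTchIV_Prop1_2_i`: the landed theorems it names, BY NAME (spec §2(c)); proves nothing new. -/
theorem N_IUTchIV_Prop1_2_i_part : N_IUTchIV_Prop1_2_i := @Literature.IUT.LogVolume.closedBall_subset_logUnits

/-- [node IUTchIV:Prop1.4(i) · S/D5 · [IUTchIV] Prop 1.4 (i), kurims p.13 · p404318,p404346 · claim · DAG status landed(p404318)] decls 2 · cites→ IUTchIV:Prop1.2 -/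
abbrev N_IUTchIV_Prop1_4_i : Prop := StatementOf @Literature.IUT.LogVolume.IntegralStructure.weightedLogVolume_const_eq_normalizedLogVolume.{u₁, u₂}
/-- partial witness (DAG row not marked discharged) of `N_IUTchIV_Prop1_4_i`: the landed theorems it names, BY NAME (spec §2(c)); proves nothing new. -/
theorem N_IUTchIV_Prop1_4_i_part : N_IUTchIV_Prop1_4_i := @Literature.IUT.LogVolume.IntegralStructure.weightedLogVolume_const_eq_normalizedLogVolume
example := @Literature.IUT.LogVolume.normalizedLocalLogVolume

/-- [node IUTchIV:Prop1.5(i) · S/D5 · [IUTchIV] Prop 1.5 (i), kurims p.14 · p404494 · claim · DAG status landed(p404494)] decls 3 · cites→ - -/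
def N_IUTchIV_Prop1_5_i : Prop :=
  StatementOf @Literature.IUT.LogVolume.Prop15.inner_crt ∧
  StatementOf @Literature.IUT.LogVolume.Prop15.norm_sq_crt
/-- partial witness (DAG row not marked discharged) of `N_IUTchIV_Prop1_5_i`: the landed theorems it names, BY NAME (spec §2(c)); proves nothing new. -/
theorem N_IUTchIV_Prop1_5_i_part : N_IUTchIV_Prop1_5_i := ⟨@Literature.IUT.LogVolume.Prop15.inner_crt, @Literature.IUT.LogVolume.Prop15.norm_sq_crt⟩
example := @Literature.IUT.LogVolume.Prop15.crt

/-- [node IUTchIV:Prop1.5(ii) · S/D5 · [IUTchIV] Prop 1.5 (ii), kurims p.14 · p404494 · claim · DAG status landed(p404494)] decls 1 · cites→ - -/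
abbrev N_IUTchIV_Prop1_5_ii : Prop := StatementOf @Literature.IUT.LogVolume.Prop15.directSum_preserved
/-- partial witness (DAG row not marked discharged) of `N_IUTchIV_Prop1_5_ii`: the landed theorems it names, BY NAME (spec §2(c)); proves nothing new. -/
theorem N_IUTchIV_Prop1_5_ii_part : N_IUTchIV_Prop1_5_ii := @Literature.IUT.LogVolume.Prop15.directSum_preserved

/-- [node IUTchIV:Prop1.6 · S/D5 · [IUTchIV] Prop 1.6, kurims p.16 · p403738 · claim · DAG status landed(p403738)] decls 6 · cites→ - -/
def N_IUTchIV_Prop1_6 : Prop :=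
  StatementOf @Literature.IUT.LogVolume.exists_le_nthPrime_div_log ∧
  StatementOf @Literature.IUT.LogVolume.exists_isEtaPrm ∧
  StatementOf @Literature.IUT.LogVolume.card_primesLE_floor_eq ∧
  StatementOf @Literature.IUT.LogVolume.log_mul_primeCounting_le_of_isEtaPrm
/-- partial witness (DAG row not marked discharged) of `N_IUTchIV_Prop1_6`: the landed theorems it names, BY NAME (spec §2(c)); proves nothing new. -/
theorem N_IUTchIV_Prop1_6_part : N_IUTchIV_Prop1_6 := ⟨@Literature.IUT.LogVolume.exists_le_nthPrime_div_log, @Literature.IUT.LogVolume.exists_isEtaPrm, @Literature.IUT.LogVolume.card_primesLE_floor_eq, @Literature.IUT.LogVolume.log_mul_primeCounting_le_of_isEtaPrm⟩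
example := @Literature.IUT.LogVolume.nthPrime
example := @Literature.IUT.LogVolume.IsEtaPrm

/-- [node IUTchIV:Prop1.7 · S/D5 · [IUTchIV] Prop 1.7, kurims p.16 · p402549 · claim · DAG status discharged(p402549)] decls 9 · cites→ - -/
def N_IUTchIV_Prop1_7 : Prop :=
  StatementOf @Literature.Algebra.PolynomialIdentities.WeightedAverage.lamTotal_pow.{u₁} ∧
  StatementOf @Literature.Algebra.PolynomialIdentities.WeightedAverage.betaTotal_mul_lamTotal_pow.{u₁} ∧
  StatementOf @Literature.Algebra.PolynomialIdentities.WeightedAverage.mul_betaTotal_mul_lamTotal_pow.{u₁} ∧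
  StatementOf @Literature.Algebra.PolynomialIdentities.WeightedAverage.weightedAverage_eq.{u₁}
/-- discharge of `N_IUTchIV_Prop1_7`: the landed theorems it names, BY NAME (spec §2(c)); proves nothing new. -/
theorem N_IUTchIV_Prop1_7_holds : N_IUTchIV_Prop1_7 := ⟨@Literature.Algebra.PolynomialIdentities.WeightedAverage.lamTotal_pow, @Literature.Algebra.PolynomialIdentities.WeightedAverage.betaTotal_mul_lamTotal_pow, @Literature.Algebra.PolynomialIdentities.WeightedAverage.mul_betaTotal_mul_lamTotal_pow, @Literature.Algebra.PolynomialIdentities.WeightedAverage.weightedAverage_eq⟩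
example := @Literature.Algebra.PolynomialIdentities.WeightedAverage.tupleBeta
example := @Literature.Algebra.PolynomialIdentities.WeightedAverage.tupleLam
example := @Literature.Algebra.PolynomialIdentities.WeightedAverage.betaTotal
example := @Literature.Algebra.PolynomialIdentities.WeightedAverage.lamTotal
example := @Literature.Algebra.PolynomialIdentities.WeightedAverage.betaAvg

/-- [node IUTchIV:Thm1.10 · S/D5 · [IUTchIV] Thm 1.10, kurims pp.22–23 · claim-form (skel III `Thm110Data.Display`, p403253)]
the displayed inequality `(1/6)·log(q) ≤ (1 + 20·d_mod/l)·(log 𝔡 + log 𝔣) + 20·(e*_mod·l + η_prm)` for one curve in initial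
Θ-data. CLAIM-FORM: a name, NO `_holds` — the tree proves only the EDGES below (the printed derivation of the display from
[IUTchIII] Cor 3.12 and the multiradial estimate with the printed `C_Θ`, and its Claim-6 shape), never the display itself.
cites→ IUTchIV:Cor2.2, IUTchIV:Prop1.6, IUTchIV:Prop1.8 -/
abbrev N_IUTchIV_Thm1_10 (X : Summit.ABC.IUTFork.Thm110Data) : Prop := X.Display
/-- EDGE (spec §3), by name: multiradial estimate ∧ Cor 3.12 ⟹ Thm 1.10's display for the curve (skel `display_of_cor312`;
[IUTchIV] proof of Thm 1.10, Steps (v)–(xi) + the printed `C_Θ ≥ −1`). -/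
theorem E_IUTchIV_Thm1_10_of_MultiradialEstimate_of_Cor3_12 (X : Summit.ABC.IUTFork.Thm110Data) :
    X.MultiradialEstimate → X.Cor312 → N_IUTchIV_Thm1_10 X :=
  X.display_of_cor312
/-- EDGE (spec §3), by name: the coefficient algebra of [IUTchIV] Thm 1.10 in Scholze–Stix's form — (1.4) with weights `j²`
⟺ `(1/6)·deg(q_E) ≤ (1 − 12/(ℓ(ℓ+1)))⁻¹·d(P)` (skel `PilotDegrees.ineq_sqWeights_iff`), and display ⟹ Claim-6 shape for the
family (skel `HeightFamily.claim6_of_thm110`) — recorded as touched names; their statements live in ForkDegrees/ForkVojta. -/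
example := @Summit.ABC.IUTFork.PilotDegrees.ineq_sqWeights_iff
example := @Summit.ABC.IUTFork.HeightFamily.claim6_of_thm110
example := @Summit.ABC.IUTFork.Thm110Data.CTheta
example := @Summit.ABC.IUTFork.Thm110Data.thm110_display
example := @Summit.ABC.IUTFork.PilotDegrees.YieldsBound
example := @Summit.ABC.IUTFork.Thm110Data.Display
example := @Summit.ABC.IUTFork.HeightFamily.Claim6
/-- [node IUTchIV:Prop2.1(ii) · S/D5 · [IUTchIV] Prop 2.1 (ii), kurims p.40 · p403738 · claim · DAG status landed(p403738)] decls 5 · cites→ - -/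
def N_IUTchIV_Prop2_1_ii : Prop :=
  StatementOf @Literature.IUT.LogVolume.exists_isXiPrm ∧
  StatementOf @Literature.IUT.LogVolume.thetaSet_empty ∧
  StatementOf @Literature.IUT.LogVolume.exists_prime_not_mem_le_of_isXiPrm
/-- partial witness (DAG row not marked discharged) of `N_IUTchIV_Prop2_1_ii`: the landed theorems it names, BY NAME (spec §2(c)); proves nothing new. -/
theorem N_IUTchIV_Prop2_1_ii_part : N_IUTchIV_Prop2_1_ii := ⟨@Literature.IUT.LogVolume.exists_isXiPrm, @Literature.IUT.LogVolume.thetaSet_empty, @Literature.IUT.LogVolume.exists_prime_not_mem_le_of_isXiPrm⟩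
example := @Literature.IUT.LogVolume.IsXiPrm
example := @Literature.IUT.LogVolume.thetaSet

/-- [node GenEll:Def1.2(i) · S/D1>D5 · [GenEll] Def 1.2 (i), kurims p.5 · p404424 · claim · DAG status discharged(p404424)] decls 1 · cites→ - -/
abbrev N_GenEll_Def1_2_i : Prop := StatementOf @Literature.NumberTheory.DiophantineGeometry.GenEll.NFPoint.ht_eq_of_ringEquiv
/-- discharge of `N_GenEll_Def1_2_i`: the landed theorems it names, BY NAME (spec §2(c)); proves nothing new. -/
theorem N_GenEll_Def1_2_i_holds : N_GenEll_Def1_2_i := @Literature.NumberTheory.DiophantineGeometry.GenEll.NFPoint.ht_eq_of_ringEquiv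

/-- [node GenEll:Def1.2(ii) · S/D1>D5 · [GenEll] Def 1.2 (ii), kurims p.5 · p403759 · claim · DAG status discharged(p403759)] decls 30 · cites→ - -/
def N_GenEll_Def1_2_ii : Prop :=
  StatementOf @Literature.NumberTheory.DiophantineGeometry.GenEll.bdLe_iff.{u₁} ∧
  StatementOf @Literature.NumberTheory.DiophantineGeometry.GenEll.bdGe_iff.{u₁} ∧
  StatementOf @Literature.NumberTheory.DiophantineGeometry.GenEll.bdEquiv_iff_abs.{u₁} ∧
  StatementOf @Literature.NumberTheory.DiophantineGeometry.GenEll.bdEquiv_iff.{u₁} ∧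
  StatementOf @Literature.NumberTheory.DiophantineGeometry.GenEll.BDLe.refl.{u₁} ∧
  StatementOf @Literature.NumberTheory.DiophantineGeometry.GenEll.BDLe.trans.{u₁} ∧
  StatementOf @Literature.NumberTheory.DiophantineGeometry.GenEll.BDLe.of_le.{u₁} ∧
  StatementOf @Literature.NumberTheory.DiophantineGeometry.GenEll.BDEquiv.bdLe.{u₁} ∧
  StatementOf @Literature.NumberTheory.DiophantineGeometry.GenEll.BDEquiv.bdGe.{u₁} ∧
  StatementOf @Literature.NumberTheory.DiophantineGeometry.GenEll.BDLe.add.{u₁} ∧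
  StatementOf @Literature.NumberTheory.DiophantineGeometry.GenEll.bdLe_add_const_iff.{u₁} ∧
  StatementOf @Literature.NumberTheory.DiophantineGeometry.GenEll.BDLe.of_bddAbove_of_bddBelow.{u₁}
/-- discharge of `N_GenEll_Def1_2_ii`: the landed theorems it names, BY NAME (spec §2(c)); proves nothing new. -/
theorem N_GenEll_Def1_2_ii_holds : N_GenEll_Def1_2_ii := ⟨@Literature.NumberTheory.DiophantineGeometry.GenEll.bdLe_iff, @Literature.NumberTheory.DiophantineGeometry.GenEll.bdGe_iff, @Literature.NumberTheory.DiophantineGeometry.GenEll.bdEquiv_iff_abs, @Literature.NumberTheory.DiophantineGeometry.GenEll.bdEquiv_iff, @Literature.NumberTheory.DiophantineGeometry.GenEll.BDLe.refl, @Literature.NumberTheory.DiophantineGeometry.GenEll.BDLe.trans, @Literature.NumberTheory.DiophantineGeometry.GenEll.BDLe.of_le, @Literature.NumberTheory.DiophantineGeometry.GenEll.BDEquiv.bdLe, @Literature.NumberTheory.DiophantineGeometry.GenEll.BDEquiv.bdGe, @Literature.NumberTheory.DiophantineGeometry.GenEll.BDLe.add, @Literature.NumberTheory.DiophantineGeometry.GenEll.bdLe_add_const_iff,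 @Literature.NumberTheory.DiophantineGeometry.GenEll.BDLe.of_bddAbove_of_bddBelow⟩
-- (+11 further theorems of this node not conjoined in the draft)
example := @Literature.NumberTheory.DiophantineGeometry.GenEll.BDLe
example := @Literature.NumberTheory.DiophantineGeometry.GenEll.BDGe
example := @Literature.NumberTheory.DiophantineGeometry.GenEll.BDEquiv
example := @Literature.NumberTheory.DiophantineGeometry.GenEll.bdSetoid
example := @Literature.NumberTheory.DiophantineGeometry.GenEll.BDClass
example := @Literature.NumberTheory.DiophantineGeometry.GenEll.BDClass.mk

/-- [node GenEll:Ex1.3(i) · S/D1>D5 · [GenEll] Ex 1.3 (i), kurims p.5 · p404288,p404424 · claim · DAG status landed(p404288)] decls 6 · cites→ GenEll:Def1.2,GenEll:Def1.5 -/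
def N_GenEll_Ex1_3_i : Prop :=
  StatementOf @Literature.NumberTheory.DiophantineGeometry.GenEll.HasFinitelyManyPoints.mono ∧
  StatementOf @Literature.NumberTheory.DiophantineGeometry.GenEll.NFPoint.degree_eq_of_ringEquiv ∧
  StatementOf @Literature.NumberTheory.DiophantineGeometry.GenEll.mem_UPle_iff_of_ringEquiv
/-- partial witness (DAG row not marked discharged) of `N_GenEll_Ex1_3_i`: the landed theorems it names, BY NAME (spec §2(c)); proves nothing new. -/
theorem N_GenEll_Ex1_3_i_part : N_GenEll_Ex1_3_i := ⟨@Literature.NumberTheory.DiophantineGeometry.GenEll.HasFinitelyManyPoints.mono, @Literature.NumberTheory.DiophantineGeometry.GenEll.NFPoint.degree_eq_of_ringEquiv, @Literature.NumberTheory.DiophantineGeometry.GenEll.mem_UPle_iff_of_ringEquiv⟩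
example := @Literature.NumberTheory.DiophantineGeometry.GenEll.NFPoint.mpoly
example := @Literature.NumberTheory.DiophantineGeometry.GenEll.HasFinitelyManyPoints
example := @Literature.NumberTheory.DiophantineGeometry.GenEll.IsGaloisFinite

/-- [node GenEll:Ex1.3(ii) · S/D1>D5 · [GenEll] Ex 1.3 (ii), kurims p.5 · p404301 · claim · DAG status landed(p404301)] decls 5 · cites→ GenEll:Def1.2,GenEll:Def1.5 -/
def N_GenEll_Ex1_3_ii : Prop :=
  StatementOf @Literature.NumberTheory.DiophantineGeometry.GenEll.CBData.exists_cbData_supportContains ∧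
  StatementOf @Literature.NumberTheory.DiophantineGeometry.GenEll.CBData.ratPoint_half_mem
/-- partial witness (DAG row not marked discharged) of `N_GenEll_Ex1_3_ii`: the landed theorems it names, BY NAME (spec §2(c)); proves nothing new. -/
theorem N_GenEll_Ex1_3_ii_part : N_GenEll_Ex1_3_ii := ⟨@Literature.NumberTheory.DiophantineGeometry.GenEll.CBData.exists_cbData_supportContains, @Literature.NumberTheory.DiophantineGeometry.GenEll.CBData.ratPoint_half_mem⟩
example := @Literature.NumberTheory.DiophantineGeometry.GenEll.CBData.stdArc
example := @Literature.NumberTheory.DiophantineGeometry.GenEll.CBData.stdNon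
example := @Literature.NumberTheory.DiophantineGeometry.GenEll.CBData.std

/-- [node GenEll:Prop1.4(ii) · S/D1>D5 · [GenEll] Prop 1.4 (ii), kurims p.6 · p404288 · claim · DAG status landed(p404288)] decls 1 · cites→ GenEll:Ex1.3 -/
abbrev N_GenEll_Prop1_4_ii : Prop := StatementOf @Literature.NumberTheory.DiophantineGeometry.GenEll.NFPoint.ht_nonneg
/-- partial witness (DAG row not marked discharged) of `N_GenEll_Prop1_4_ii`: the landed theorems it names, BY NAME (spec §2(c)); proves nothing new. -/
theorem N_GenEll_Prop1_4_ii_part : N_GenEll_Prop1_4_ii := @Literature.NumberTheory.DiophantineGeometry.GenEll.NFPoint.ht_nonneg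

/-- [node GenEll:Prop1.4(iv) · S/D1>D5 · [GenEll] Prop 1.4 (iv), kurims p.6 · p404288,p404827 · claim · DAG status landed(p404288)] decls 2 · cites→ GenEll:Ex1.3 -/
abbrev N_GenEll_Prop1_4_iv : Prop := StatementOf @Literature.NumberTheory.DiophantineGeometry.GenEll.northcott_UPle_holds
/-- partial witness (DAG row not marked discharged) of `N_GenEll_Prop1_4_iv`: the landed theorems it names, BY NAME (spec §2(c)); proves nothing new. -/
theorem N_GenEll_Prop1_4_iv_part : N_GenEll_Prop1_4_iv := @Literature.NumberTheory.DiophantineGeometry.GenEll.northcott_UPle_holds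
example := @Literature.NumberTheory.DiophantineGeometry.GenEll.northcott_UPle

/-- [node GenEll:Def1.5(i) · S/D1>D5 · [GenEll] Def 1.5 (i), kurims p.8 · p404288,p404424 · claim · DAG status discharged(p404288)] decls 3 · cites→ - -/
def N_GenEll_Def1_5_i : Prop :=
  StatementOf @Literature.NumberTheory.DiophantineGeometry.GenEll.NFPoint.natDegree_mpoly ∧
  StatementOf @Literature.NumberTheory.DiophantineGeometry.GenEll.NFPoint.isMinimal_iff_natDegree ∧
  StatementOf @Literature.NumberTheory.DiophantineGeometry.GenEll.NFPoint.isMinimal_iff_of_ringEquiv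
/-- discharge of `N_GenEll_Def1_5_i`: the landed theorems it names, BY NAME (spec §2(c)); proves nothing new. -/
theorem N_GenEll_Def1_5_i_holds : N_GenEll_Def1_5_i := ⟨@Literature.NumberTheory.DiophantineGeometry.GenEll.NFPoint.natDegree_mpoly, @Literature.NumberTheory.DiophantineGeometry.GenEll.NFPoint.isMinimal_iff_natDegree, @Literature.NumberTheory.DiophantineGeometry.GenEll.NFPoint.isMinimal_iff_of_ringEquiv⟩

/-- [node GenEll:Def1.5(iii) · S/D1>D5 · [GenEll] Def 1.5 (iii), kurims p.8 · p404288,p404424 · claim · DAG status discharged(p404288)] decls 2 · cites→ - -/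
def N_GenEll_Def1_5_iii : Prop :=
  StatementOf @Literature.NumberTheory.DiophantineGeometry.GenEll.NFPoint.logDiff_nonneg ∧
  StatementOf @Literature.NumberTheory.DiophantineGeometry.GenEll.NFPoint.logDiff_eq_of_ringEquiv
/-- discharge of `N_GenEll_Def1_5_iii`: the landed theorems it names, BY NAME (spec §2(c)); proves nothing new. -/
theorem N_GenEll_Def1_5_iii_holds : N_GenEll_Def1_5_iii := ⟨@Literature.NumberTheory.DiophantineGeometry.GenEll.NFPoint.logDiff_nonneg, @Literature.NumberTheory.DiophantineGeometry.GenEll.NFPoint.logDiff_eq_of_ringEquiv⟩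

/-- [node GenEll:Def1.5(iv) · S/D1>D5 · [GenEll] Def 1.5 (iv), kurims p.8 · p404288,p404424 · claim · DAG status discharged(p404288)] decls 2 · cites→ - -/
def N_GenEll_Def1_5_iv : Prop :=
  StatementOf @Literature.NumberTheory.DiophantineGeometry.GenEll.NFPoint.logCond_nonneg ∧
  StatementOf @Literature.NumberTheory.DiophantineGeometry.GenEll.NFPoint.logCond_eq_of_ringEquiv
/-- discharge of `N_GenEll_Def1_5_iv`: the landed theorems it names, BY NAME (spec §2(c)); proves nothing new. -/
theorem N_GenEll_Def1_5_iv_holds : N_GenEll_Def1_5_iv := ⟨@Literature.NumberTheory.DiophantineGeometry.GenEll.NFPoint.logCond_nonneg, @Literature.NumberTheory.DiophantineGeometry.GenEll.NFPoint.logCond_eq_of_ringEquiv⟩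

/-- [node GenEll:Thm2.1(ii) · S/D1>D5 · [GenEll] Thm 2.1 (ii), kurims p.11 · p404424 · claim · DAG status landed(p404424)] decls 1 · cites→ GenEll:Def1.2,GenEll:Def1.5,GenEll:Ex1.3,GenEll:Rmk1.4.1,GenEll:Rmk1.5.1 -/
abbrev N_GenEll_Thm2_1_ii : Prop := StatementOf @Literature.NumberTheory.DiophantineGeometry.GenEll.NFPoint.inU_iff_of_ringEquiv
/-- partial witness (DAG row not marked discharged) of `N_GenEll_Thm2_1_ii`: the landed theorems it names, BY NAME (spec §2(c)); proves nothing new. -/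
theorem N_GenEll_Thm2_1_ii_part : N_GenEll_Thm2_1_ii := @Literature.NumberTheory.DiophantineGeometry.GenEll.NFPoint.inU_iff_of_ringEquiv

end

end Summit.ABC.IUTFork.DAG
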